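import Summits.QuantumFields.YangMills.Theorems.BalabanUVNodesN16UniformScalarAverage
import Summits.QuantumFields.BalabanUV.T4Continuum.Support.NE3EnergyRateFlatClass
import HarnessLib

/-!
# YM-DAG node N16 (NE3), the re-keyed N07 in-edge — SCALAR GAUGE CALCULUS, FLUX QUANTISATION, AND THE PERIODIC SEAM FIELD: the three lemmas behind «(T8) with a
# `k`-uniform class constant on uniform-curvature scalar data» (file 2 of 3 of the g6 piece; file 3 `…N16Exists8UniformScalar` assembles)

Cell `pub-ymgap`, width seat `pub-ymgap-dag-n16-w2` (director-ym №197 ∕ HUMAN RULING D-0149), generation 6.  `--kind proof --supports stmt-QuantumFields-27366 --as helper`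
(K3⁸, KEY MAP v2).  `bears_on: R4∕N16`, edge N07 → N16.  COUNT-NEUTRAL.

HONEST FRAMING.  Kernel bookkeeping over landed modules BY NAME (pub-balaban `T4AveragingDeficitWallBoundary` §1 scalar calculus; `NE3EnergyRateFlatClass.gaugeAct_axialFn_eq_flatCfg`;
`B7Prop1Explicit.stokes`; `T4AveragingDeficitNonAbelian.hol_add_period`) and file 1.  Nothing of Bałaban is asserted or refuted; DischargeTest `stub_reg910Slot` NOT closed; no K3⁸ v6
stub named or closed; N16 ∕ N07 NOT discharged; counts UNMOVED (typed 28∕28 · discharged 5∕27 · A 5∕28).  R4 closes the conditional finite-𝕋⁴ rung `BalabanLadder.UV` only; NOT ℝ⁴ ∕ OS ∕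
mass gap; the YM mass gap (Clay) is NOT proved by any of this.

WHAT IS PROVED ([folklore], 0 `sorry`, 0 `def`; matrix size `n : Type`).  §1 SCALAR GAUGE CALCULUS: `exp_smul_one_comm`, `hol_scalarCfg_sub` (quotients), `scalarCfg_eq_sub_mul`,
`isUnitaryCfg_scalarCfg_sub`, ★ `exists_central_gauge_of_hol_plaqWord_eq` — two `U(N)`-valued SCALAR configurations on `ℤ^d` with the same plaquette variables differ by a CENTRAL
unitary gauge (the inverse complete axial gauge of the flat quotient; not periodic in general — it carries the holonomy).  §2 FLUX QUANTISATION: `hol_rectWord_period_eq_one` (the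
`N × N` period rectangle of an `N`-periodic scalar field has trivial holonomy), `smul_one_inj`, ★ `cexp_sq_mul_flux_eq_one`: `e^{iN²ω} = 1` for an `N`-periodic scalar field all of
whose `(e_κ,e_μ)`-plaquette variables are `e^{iω}·1` (abelian Stokes).  §3 THE PERIODIC SEAM FIELD of period `P` and flux `f` (PRECEDENT on the ZMod-torus carriers of nodes N07∕K0:
dag-n07-e `…N07UniformFluxHolonomy`, `…K0UniformFluxConfig`; re-derived here on the `IsPeriodicCfg` carrier of leaf-05∕06): exponents `i f (x₀ mod P)` on `e₁`-bonds,
`−i f P (x₁ mod P)` on the `e₀`-bonds of the last layer `x₀ ≡ P − 1`, `0` else — `emod_add_one`, `emod_add_zsmul_e`, `seam_plaq01` (the `(e₀,e₁)` exponent is `if`, except `i(f − fP²)`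
on the doubly-last plaquettes), ★ `hol_plaqWord_seam` (given `e^{ifP²} = 1` its plaquette variables are EXACTLY the Landau field's of file 1: uniform curvature `f`), `isPeriodicCfg_seam`,
`isUnitaryCfg_seam`.

DEPENDENCES (by name): `T4AveragingDeficitWallBoundary` (`scalarCfg`, `hol_scalarCfg`, `exp_add_smul_one`, `IsPeriodicCfg`, `fin_one_ne_zero`, `fin_zero_ne_one`);
`MinimalActionClassSixNeg` (`isUnitaryCfg_scalarCfg_imag`, `isPeriodicCfg_scalarCfg`); `FederbushMean.cexp_smul_one`; `NE3EnergyRateFlatClass.gaugeAct_axialFn_eq_flatCfg`;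
`B7Prop4Flat.asum_sub`; `B7Prop1Explicit` (`stokes`, `rectWord`, `hol_append`, `hol_revWord'`, `revWord_seg`, `disp_seg`, `axialFn`, `asum_plaqWord`, `hol_plaqWord_self`,
`e_apply`); `T4AveragingDeficitNonAbelian.hol_add_period`; `MinimalActionWitness.flatCfg`; Mathlib (`Int.add_emod`, `Int.emod_eq_of_lt`, `Int.add_emod_right`, `Complex.exp_sum`,
`Complex.exp_nat_mul`).
-/

open scoped BigOperators Matrix Matrix.Norms.L2Operator
open NormedSpace Finset

namespace Summit.QuantumFields.YangMills.BalabanUVNodes.N16UniformScalarSeam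

open Literature.MathematicalPhysics.QuantumFieldTheory.Balaban1983to89
open B7Prop1Explicit B7Prop2Explicit MatrixLog UnitaryModel
open T4AveragingDeficitWall hiding Site Plane Plaq Bond
open T4AveragingDeficitWallBoundary (scalarCfg hol_scalarCfg val_hol_scalarCfg exp_add_smul_one smul_one_mem_unitary IsPeriodicCfg fin_one_ne_zero
  fin_zero_ne_one)
open T4AveragingDeficitNonAbelian (hol_add_period)
open FederbushMean (cexp_smul_one norm_smul_one_sub_one norm_smul_one_eq)
open B7Prop4Flat (asum_sub)
open Summit.QuantumFields.BalabanUV.T4Continuum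
open MinimalActionClassSixNeg (isUnitaryCfg_scalarCfg_imag isPeriodicCfg_scalarCfg)
open NE3EnergyRateFlatClass (gaugeAct_axialFn_eq_flatCfg)
open MinimalActionWitness (flatCfg)

noncomputable section

variable {d : ℕ} {n : Type} [Fintype n] [DecidableEq n]

/-! ## §1 Scalar gauge calculus: quotients, and «same plaquettes ⟹ central gauge» -/

/-- A scalar `e^{z}·1` is central in `M_n(ℂ)`. [folklore] -/
theorem exp_smul_one_comm (z : ℂ) (X : Matrix n n ℂ) : exp (z • (1 : Matrix n n ℂ)) * X = X * exp (z • (1 : Matrix n n ℂ)) := by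
  rw [← cexp_smul_one, smul_mul_assoc, one_mul, mul_smul_comm, mul_one]

/-- The plaquette variables of a quotient of scalar configurations: `(e^{F−G})(∂p) = e^{F}(∂p) · (e^{G}(∂p))⁻¹`. [folklore] -/
theorem hol_scalarCfg_sub (F G : B7Prop1Explicit.Site d → Fin d → ℂ) (x : B7Prop1Explicit.Site d) (w : List (Letter d)) :
    hol (scalarCfg (n := n) (F - G)) x w = hol (scalarCfg (n := n) F) x w * (hol (scalarCfg (n := n) G) x w)⁻¹ := by
  apply Units.ext
  rw [hol_scalarCfg, hol_scalarCfg, hol_scalarCfg, Units.val_mul, val_inv_expUnit, val_expUnit, val_expUnit, val_expUnit, asum_sub,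
    ← neg_smul, ← exp_add_smul_one, sub_eq_add_neg]

/-- The scalar configuration with exponents `F` is the pointwise product of the ones with exponents `F − G` and `G`. [folklore] -/
theorem scalarCfg_eq_sub_mul (F G : B7Prop1Explicit.Site d → Fin d → ℂ) (x : B7Prop1Explicit.Site d) (κ : Fin d) :
    scalarCfg (n := n) F x κ = scalarCfg (n := n) (F - G) x κ * scalarCfg (n := n) G x κ := by
  apply Units.ext
  simp only [scalarCfg, Units.val_mul, val_expUnit, Pi.sub_apply, ← exp_add_smul_one, sub_add_cancel]

/-- A quotient of `U(N)`-valued scalar configurations is `U(N)`-valued. [folklore] -/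
theorem isUnitaryCfg_scalarCfg_sub {F G : B7Prop1Explicit.Site d → Fin d → ℂ} (hF : IsUnitaryCfg (scalarCfg (n := n) F))
    (hG : IsUnitaryCfg (scalarCfg (n := n) G)) : IsUnitaryCfg (scalarCfg (n := n) (F - G)) := by
  intro x κ
  have h : scalarCfg (n := n) (F - G) x κ = scalarCfg (n := n) F x κ * (scalarCfg (n := n) G x κ)⁻¹ := by
    rw [scalarCfg_eq_sub_mul F G x κ, mul_inv_cancel_right]
  rw [h]
  exact (unitaryUnits (Matrix n n ℂ)).mul_mem (hF x κ) ((unitaryUnits (Matrix n n ℂ)).inv_mem (hG x κ))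

/-- **★ SAME PLAQUETTES ⟹ RELATED BY A CENTRAL UNITARY GAUGE** (scalar configurations on `ℤ^d`): if the `U(N)`-valued scalar configurations `e^{F}·1`, `e^{G}·1` have the same
plaquette variables, then `e^{F}·1 = (e^{G}·1)^{u}` for a unitary gauge `u` whose values are scalars (the inverse complete axial gauge of the flat quotient `e^{F−G}·1`,
`NE3EnergyRateFlatClass.gaugeAct_axialFn_eq_flatCfg`).  `u` is not periodic in general (it carries the holonomy). [folklore] -/
theorem exists_central_gauge_of_hol_plaqWord_eq [Nonempty n] {F G : B7Prop1Explicit.Site d → Fin d → ℂ} (hF : IsUnitaryCfg (scalarCfg (n := n) F))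
    (hG : IsUnitaryCfg (scalarCfg (n := n) G))
    (h : ∀ (x : B7Prop1Explicit.Site d) (κ μ : Fin d), κ ≠ μ → hol (scalarCfg (n := n) F) x (plaqWord κ μ) = hol (scalarCfg (n := n) G) x (plaqWord κ μ)) :
    ∃ u : B7Prop1Explicit.Site d → (Matrix n n ℂ)ˣ, (∀ x, u x ∈ unitaryUnits (Matrix n n ℂ)) ∧ (∀ (x : B7Prop1Explicit.Site d) (X : Matrix n n ℂ), (u x : Matrix n n ℂ) * X = X * u x) ∧
      scalarCfg (n := n) F = gaugeAct u (scalarCfg (n := n) G) := by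
  set Q := scalarCfg (n := n) (F - G) with hQ
  have hQU : IsUnitaryCfg Q := isUnitaryCfg_scalarCfg_sub hF hG
  have hQflat : ∀ (x : B7Prop1Explicit.Site d) (κ μ : Fin d), κ ≠ μ → hol Q x (plaqWord κ μ) = 1 := by
    intro x κ μ hκμ
    rw [hQ, hol_scalarCfg_sub, h x κ μ hκμ, mul_inv_cancel]
  have hax := gaugeAct_axialFn_eq_flatCfg hQU hQflat 0
  refine ⟨fun x => (axialFn Q 0 x)⁻¹, fun x => (unitaryUnits (Matrix n n ℂ)).inv_mem (hol_mem_of hQU _ _), fun x X => ?_, ?_⟩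
  · -- centrality: `u x = (e^{A(Γ)}·1)⁻¹ = e^{−A(Γ)}·1`
    show (((axialFn Q 0 x)⁻¹ : (Matrix n n ℂ)ˣ) : Matrix n n ℂ) * X = X * (((axialFn Q 0 x)⁻¹ : (Matrix n n ℂ)ˣ) : Matrix n n ℂ)
    rw [axialFn, hQ, hol_scalarCfg, val_inv_expUnit, val_expUnit, ← neg_smul]
    exact exp_smul_one_comm _ X
  · funext x κ
    have hx := congrFun (congrFun hax x) κ
    -- `v₀(x) · Q(x,κ) · v₀(x+e_κ)⁻¹ = 1`
    simp only [gaugeAct, flatCfg] at hx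
    have hQx : Q x κ = (axialFn Q 0 x)⁻¹ * axialFn Q 0 (x + e κ) := by
      have := congrArg (fun g => (axialFn Q 0 x)⁻¹ * g * axialFn Q 0 (x + e κ)) hx
      simpa [mul_assoc] using this
    rw [scalarCfg_eq_sub_mul F G x κ, ← hQ, hQx, gaugeAct, inv_inv]
    -- scalars commute: `u⁻¹ w G = u⁻¹ G w`
    have hc : axialFn Q 0 (x + e κ) * scalarCfg (n := n) G x κ = scalarCfg (n := n) G x κ * axialFn Q 0 (x + e κ) := by
      apply Units.ext
      rw [Units.val_mul, Units.val_mul, scalarCfg, val_expUnit]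
      exact (exp_smul_one_comm _ _).symm
    rw [mul_assoc, hc, ← mul_assoc]

/-! ## §2 Flux quantisation: `e^{iN²ω} = 1` for an `N`-periodic scalar field of uniform curvature `ω` -/

/-- **The period rectangle has trivial holonomy**: for an `N`-periodic SCALAR configuration, the `N × N` rectangle `[+Ne_κ, +Ne_μ, −Ne_κ, −Ne_μ]` based anywhere has
holonomy `1` (periodicity makes the opposite sides inverse to each other, and scalars commute). [folklore] -/
theorem hol_rectWord_period_eq_one (G : B7Prop1Explicit.Site d → Fin d → ℂ) {N : ℕ} (hP : IsPeriodicCfg (scalarCfg (n := n) G) (N : ℤ))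
    (x : B7Prop1Explicit.Site d) (κ μ : Fin d) :
    hol (scalarCfg (n := n) G) x (rectWord N N κ μ) = 1 := by
  set V := scalarCfg (n := n) G with hV
  have hA : hol V (x + (N : ℤ) • e κ + (N : ℤ) • e μ) (seg κ (-(N : ℤ))) = (hol V x (seg κ (N : ℤ)))⁻¹ := by
    rw [← revWord_seg, hol_revWord' V (x := x + (N : ℤ) • e μ) _ _ (by rw [disp_seg]; abel), hol_add_period hP μ]
  have hB : hol V (x + (N : ℤ) • e κ) (seg μ (N : ℤ)) = hol V x (seg μ (N : ℤ)) := hol_add_period hP κ _ _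
  have hB' : hol V (x + (N : ℤ) • e μ) (seg μ (-(N : ℤ))) = (hol V x (seg μ (N : ℤ)))⁻¹ := by
    rw [← revWord_seg, hol_revWord' V (x := x) _ _ (by rw [disp_seg])]
  rw [rectWord]
  simp only [hol_append, disp_append, disp_seg]
  have e2 : x + ((N : ℤ) • e κ + (N : ℤ) • e μ) = x + (N : ℤ) • e κ + (N : ℤ) • e μ := by abel
  have e3 : x + ((N : ℤ) • e κ + (N : ℤ) • e μ + -(N : ℤ) • e κ) = x + (N : ℤ) • e μ := by rw [neg_smul]; abel
  rw [e2, e3, hA, hB, hB']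
  -- `a b a⁻¹ b⁻¹ = 1` for the scalars `a, b`
  have hc : hol V x (seg κ (N : ℤ)) * hol V x (seg μ (N : ℤ)) = hol V x (seg μ (N : ℤ)) * hol V x (seg κ (N : ℤ)) := by
    apply Units.ext
    rw [Units.val_mul, Units.val_mul, hV, hol_scalarCfg, hol_scalarCfg, val_expUnit, val_expUnit]
    exact exp_smul_one_comm _ _
  rw [hc]; group

omit [Fintype n] in
/-- `c·1 = c'·1` in `M_n(ℂ)` forces `c = c'` (`n` non-empty). [folklore] -/
theorem smul_one_inj [Nonempty n] {c c' : ℂ} (h : c • (1 : Matrix n n ℂ) = c' • (1 : Matrix n n ℂ)) : c = c' := by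
  obtain ⟨i⟩ := ‹Nonempty n›
  have := congrArg (fun M : Matrix n n ℂ => M i i) h
  simpa using this

/-- **★ FLUX QUANTISATION**: if the `N`-periodic scalar configuration `e^{G}·1` has ALL its `(e_κ,e_μ)`-plaquette variables equal to `e^{iω}·1` (`κ ≠ μ`), then `e^{iN²ω} = 1`
— the total flux through the `(e_κ,e_μ)` period torus is an integer multiple of `2π` (abelian Stokes `B7Prop1Explicit.stokes` + the trivial period rectangle). [folklore] -/
theorem cexp_sq_mul_flux_eq_one [Nonempty n] (G : B7Prop1Explicit.Site d → Fin d → ℂ) {N : ℕ} (hP : IsPeriodicCfg (scalarCfg (n := n) G) (N : ℤ))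
    {κ μ : Fin d} {ω : ℝ} (hcurv : ∀ x : B7Prop1Explicit.Site d, hol (scalarCfg (n := n) G) x (plaqWord κ μ) = expUnit ((((ω : ℝ) : ℂ) * Complex.I) • (1 : Matrix n n ℂ))) :
    Complex.exp ((((N : ℝ) ^ 2 * ω : ℝ) : ℂ) * Complex.I) = 1 := by
  have h1 := congrArg (fun u : (Matrix n n ℂ)ˣ => (u : Matrix n n ℂ)) (hol_rectWord_period_eq_one (n := n) G hP 0 κ μ)
  simp only [Units.val_one] at h1
  rw [hol_scalarCfg, val_expUnit, ← cexp_smul_one] at h1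
  have h1' : Complex.exp (asum G 0 (rectWord N N κ μ)) = 1 := by
    exact smul_one_inj (n := n) (c := Complex.exp (asum G 0 (rectWord N N κ μ))) (c' := 1) (by rw [one_smul]; exact h1)
  have h2 : ∀ y : B7Prop1Explicit.Site d, Complex.exp (asum G y (plaqWord κ μ)) = Complex.exp (((ω : ℝ) : ℂ) * Complex.I) := by
    intro y
    have := congrArg (fun u : (Matrix n n ℂ)ˣ => (u : Matrix n n ℂ)) (hcurv y)
    rw [hol_scalarCfg, val_expUnit, val_expUnit, ← cexp_smul_one, ← cexp_smul_one] at this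
    exact smul_one_inj this
  rw [stokes, Complex.exp_sum] at h1'
  simp_rw [Complex.exp_sum, h2] at h1'
  rw [Finset.prod_const, Finset.prod_const, Finset.card_range, ← pow_mul, ← Complex.exp_nat_mul] at h1'
  rw [← h1']
  congr 1
  push_cast
  ring

/-! ## §3 The periodic seam field: an `(P)`-periodic scalar configuration with the Landau field's plaquette variables (given `e^{ifP²} = 1`) -/

/-- Division with remainder, one step: `(t + 1) mod P = 0` on the last residue `t mod P = P − 1`, `= (t mod P) + 1` otherwise (`P ≥ 1`). [folklore] -/
theorem emod_add_one {P : ℕ} (hP : 1 ≤ P) (t : ℤ) :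
    (t + 1) % (P : ℤ) = if t % (P : ℤ) = (P : ℤ) - 1 then 0 else t % (P : ℤ) + 1 := by
  have hP0 : (0 : ℤ) < P := by exact_mod_cast hP
  have hlt := Int.emod_lt_of_pos t hP0
  have hge := Int.emod_nonneg t hP0.ne'
  rw [Int.add_emod]
  split_ifs with h
  · rw [h]
    rcases Nat.lt_or_ge P 2 with hP1 | hP2
    · have : P = 1 := by omega
      subst this; simp
    · have h1 : (1 : ℤ) % (P : ℤ) = 1 := Int.emod_eq_of_lt (by norm_num) (by exact_mod_cast hP2)
      rw [h1, sub_add_cancel, Int.emod_self]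
  · rcases Nat.lt_or_ge P 2 with hP1 | hP2
    · have : P = 1 := by omega
      subst this
      exfalso; apply h; simp
    · have h1 : (1 : ℤ) % (P : ℤ) = 1 := Int.emod_eq_of_lt (by norm_num) (by exact_mod_cast hP2)
      rw [h1]
      exact Int.emod_eq_of_lt (by omega) (by omega)

/-- Shifting by a multiple of `P` does not change residues mod `P`. [folklore] -/
theorem emod_add_zsmul_e (P : ℤ) (x : B7Prop1Explicit.Site (d + 2)) (ν i : Fin (d + 2)) :
    ((x + P • e ν) i) % P = (x i) % P := by
  rw [Pi.add_apply, Pi.smul_apply, smul_eq_mul, e_apply]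
  split_ifs
  · rw [mul_one, Int.add_emod_right]
  · rw [mul_zero, add_zero]

section Seam

variable {S : B7Prop1Explicit.Site (d + 2) → Fin (d + 2) → ℂ} {f : ℝ} {P : ℕ}
  (hS : ∀ (x : B7Prop1Explicit.Site (d + 2)) (κ : Fin (d + 2)),
    S x κ = ((if κ = 1 then f * (((x 0 % (P : ℤ) : ℤ)) : ℝ)
      else if κ = 0 then (if x 0 % (P : ℤ) = (P : ℤ) - 1 then -(f * P * (((x 1 % (P : ℤ) : ℤ)) : ℝ)) else 0) else 0 : ℝ) : ℂ) * Complex.I)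
include hS

/-- The seam field's `(e₀,e₁)`-plaquette exponent: `i·f`, except on the doubly-last plaquettes (`x₀ ≡ x₁ ≡ P − 1`) where it is `i(f − fP²)` (`P ≥ 1`). [folklore] -/
theorem seam_plaq01 (hP : 1 ≤ P) (x : B7Prop1Explicit.Site (d + 2)) :
    asum S x (plaqWord 0 1)
      = ((if x 0 % (P : ℤ) = (P : ℤ) - 1 ∧ x 1 % (P : ℤ) = (P : ℤ) - 1 then f - f * (P : ℝ) ^ 2 else f : ℝ) : ℂ) * Complex.I := by
  rw [asum_plaqWord, hS, hS, hS, hS]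
  have h00 : ((x + e (0 : Fin (d + 2))) 0 : ℤ) = x 0 + 1 := by simp [e_apply]
  have h01 : ((x + e (0 : Fin (d + 2))) 1 : ℤ) = x 1 := by simp [e_apply]
  have h10 : ((x + e (1 : Fin (d + 2))) 0 : ℤ) = x 0 := by simp [e_apply]
  have h11 : ((x + e (1 : Fin (d + 2))) 1 : ℤ) = x 1 + 1 := by simp [e_apply]
  simp only [fin_zero_ne_one, fin_one_ne_zero, if_true, if_false, h00, h10, h11, emod_add_one hP]
  by_cases h0 : x 0 % (P : ℤ) = (P : ℤ) - 1 <;> by_cases h1 : x 1 % (P : ℤ) = (P : ℤ) - 1 <;>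
    simp only [h0, h1, if_true, if_false, and_true, and_false] <;> push_cast <;> ring

/-- **★ THE SEAM FIELD HAS THE LANDAU FIELD's PLAQUETTE VARIABLES** (given the flux quantisation `e^{ifP²} = 1`, `P ≥ 1`): `e^{if}·1` on `(e₀,e₁)`, `e^{−if}·1` on `(e₁,e₀)`,
`1` on every other plaquette. [folklore] -/
theorem hol_plaqWord_seam (hP : 1 ≤ P) (hq : Complex.exp ((((f * (P : ℝ) ^ 2 : ℝ)) : ℂ) * Complex.I) = 1) (x : B7Prop1Explicit.Site (d + 2)) (κ μ : Fin (d + 2)) :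
    hol (scalarCfg (n := n) S) x (plaqWord κ μ)
      = expUnit ((((if κ = 0 ∧ μ = 1 then f else if κ = 1 ∧ μ = 0 then -f else 0 : ℝ) : ℂ) * Complex.I) • (1 : Matrix n n ℂ)) := by
  -- the exponent of a general plaquette in terms of the `(0,1)` one
  have hneg : asum S x (plaqWord 1 0) = -asum S x (plaqWord 0 1) := by
    rw [asum_plaqWord, asum_plaqWord]; ring
  have hq' : exp ((((-(f * (P : ℝ) ^ 2) : ℝ) : ℂ) * Complex.I) • (1 : Matrix n n ℂ)) = 1 := by
    rw [← cexp_smul_one]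
    have : Complex.exp ((((-(f * (P : ℝ) ^ 2) : ℝ) : ℂ)) * Complex.I) = 1 := by
      rw [show (((-(f * (P : ℝ) ^ 2) : ℝ) : ℂ)) * Complex.I = -((((f * (P : ℝ) ^ 2 : ℝ)) : ℂ) * Complex.I) by push_cast; ring, Complex.exp_neg, hq, inv_one]
    rw [this, one_smul]
  have hq'' : exp (((((f * (P : ℝ) ^ 2 : ℝ)) : ℂ) * Complex.I) • (1 : Matrix n n ℂ)) = 1 := by
    rw [← cexp_smul_one, hq, one_smul]
  -- the `(0,1)` value as a unit
  have h01 : hol (scalarCfg (n := n) S) x (plaqWord 0 1) = expUnit ((((f : ℝ) : ℂ) * Complex.I) • (1 : Matrix n n ℂ)) := by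
    apply Units.ext
    rw [hol_scalarCfg, val_expUnit, val_expUnit, seam_plaq01 hS hP]
    split_ifs
    · rw [show (((f - f * (P : ℝ) ^ 2 : ℝ)) : ℂ) * Complex.I = ((f : ℝ) : ℂ) * Complex.I + (((-(f * (P : ℝ) ^ 2) : ℝ) : ℂ)) * Complex.I by push_cast; ring,
        exp_add_smul_one, hq', mul_one]
    · rfl
  by_cases hκ0 : κ = 0 <;> by_cases hκ1 : κ = 1 <;> by_cases hμ0 : μ = 0 <;> by_cases hμ1 : μ = 1
  all_goals (first | (exfalso; exact fin_zero_ne_one (hκ0.symm.trans hκ1)) | (exfalso; exact fin_zero_ne_one (hμ0.symm.trans hμ1)) | skip)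
  · -- κ = 0, μ = 0
    subst hκ0; subst hμ0
    rw [hol_plaqWord_self]; apply Units.ext; simp
  · -- κ = 0, μ = 1
    subst hκ0; subst hμ1
    rw [h01]; simp
  · -- κ = 0, μ ≥ 2
    subst hκ0
    apply Units.ext
    rw [hol_scalarCfg, val_expUnit, val_expUnit, asum_plaqWord, hS, hS, hS, hS]
    have ha : ((x + e μ) 0 : ℤ) = x 0 := by simp [e_apply, Ne.symm hμ0]
    have hb : ((x + e μ) 1 : ℤ) = x 1 := by simp [e_apply, Ne.symm hμ1]
    simp only [hμ0, hμ1, if_false, if_true, ha, hb, fin_zero_ne_one, and_false]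
    congr 1; push_cast; ring
  · -- κ = 1, μ = 0
    subst hκ1; subst hμ0
    apply Units.ext
    rw [hol_scalarCfg, val_expUnit, val_expUnit, hneg, seam_plaq01 hS hP]
    simp only [fin_one_ne_zero, false_and, and_self, if_true, if_false]
    split_ifs
    · rw [show (-(((f - f * (P : ℝ) ^ 2 : ℝ) : ℂ) * Complex.I)) = (((-f : ℝ) : ℂ)) * Complex.I + ((((f * (P : ℝ) ^ 2 : ℝ)) : ℂ)) * Complex.I by push_cast; ring,
        exp_add_smul_one, hq'', mul_one]
    · congr 1; push_cast; ring
  · -- κ = 1, μ = 1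
    subst hκ1; subst hμ1
    rw [hol_plaqWord_self]; apply Units.ext; simp
  · -- κ = 1, μ ≥ 2
    subst hκ1
    apply Units.ext
    rw [hol_scalarCfg, val_expUnit, val_expUnit, asum_plaqWord, hS, hS, hS, hS]
    have ha : ((x + e μ) 0 : ℤ) = x 0 := by simp [e_apply, Ne.symm hμ0]
    simp only [hμ0, hμ1, if_false, if_true, ha, fin_one_ne_zero, and_false]
    congr 1; push_cast; ring
  · -- κ ≥ 2, μ = 0
    subst hμ0
    apply Units.ext
    rw [hol_scalarCfg, val_expUnit, val_expUnit, asum_plaqWord, hS, hS, hS, hS]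
    have ha : ((x + e κ) 0 : ℤ) = x 0 := by simp [e_apply, Ne.symm hκ0]
    have hb : ((x + e κ) 1 : ℤ) = x 1 := by simp [e_apply, Ne.symm hκ1]
    simp only [hκ0, hκ1, if_false, if_true, ha, hb, false_and]
    congr 1; push_cast; ring
  · -- κ ≥ 2, μ = 1
    subst hμ1
    apply Units.ext
    rw [hol_scalarCfg, val_expUnit, val_expUnit, asum_plaqWord, hS, hS, hS, hS]
    have ha : ((x + e κ) 0 : ℤ) = x 0 := by simp [e_apply, Ne.symm hκ0]
    simp only [hκ0, hκ1, if_false, if_true, ha, false_and]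
    congr 1; push_cast; ring
  · -- κ, μ ≥ 2
    apply Units.ext
    rw [hol_scalarCfg, val_expUnit, val_expUnit, asum_plaqWord, hS, hS, hS, hS]
    simp only [hκ0, hκ1, hμ0, hμ1, if_false, false_and]
    congr 1; push_cast; ring

omit hS in
/-- The seam exponents only read residues mod `P`, so the seam field is `P`-periodic. [folklore] -/
theorem isPeriodicCfg_seam : IsPeriodicCfg (scalarCfg (n := n) (fun (x : B7Prop1Explicit.Site (d + 2)) (κ : Fin (d + 2)) =>
      ((if κ = 1 then f * (((x 0 % (P : ℤ) : ℤ)) : ℝ)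
        else if κ = 0 then (if x 0 % (P : ℤ) = (P : ℤ) - 1 then -(f * P * (((x 1 % (P : ℤ) : ℤ)) : ℝ)) else 0) else 0 : ℝ) : ℂ) * Complex.I)) (P : ℤ) := by
  apply isPeriodicCfg_scalarCfg
  intro x ν μ
  simp only [emod_add_zsmul_e]

omit hS in
/-- The seam field is `U(N)`-valued. [folklore] -/
theorem isUnitaryCfg_seam : IsUnitaryCfg (scalarCfg (n := n) (fun (x : B7Prop1Explicit.Site (d + 2)) (κ : Fin (d + 2)) =>
      ((if κ = 1 then f * (((x 0 % (P : ℤ) : ℤ)) : ℝ)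
        else if κ = 0 then (if x 0 % (P : ℤ) = (P : ℤ) - 1 then -(f * P * (((x 1 % (P : ℤ) : ℤ)) : ℝ)) else 0) else 0 : ℝ) : ℂ) * Complex.I)) :=
  isUnitaryCfg_scalarCfg_imag _

end Seam

end

end Summit.QuantumFields.YangMills.BalabanUVNodes.N16UniformScalarSeam
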